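import Literature.AlgebraicGeometry.Resolution.KollarSurfaceOrderReductionTameLocal
import Literature.AlgebraicGeometry.Resolution.NormalCrossingsStrictification
import HarnessLib

/-!
# Order reduction for marked ideals in the tame regime `ord < p`: every closed point of dimension `≤ 2`

Topic: `Literature/AlgebraicGeometry/Resolution`. Completion of `KollarSurfaceOrderReductionTameLocal.lean`
(J. Kollár, *Lectures on Resolution of Singularities* (2007), Thm. 3.69 via 3.104 Step 2.2 and
3.111 Step 1; BGMW arXiv:1206.3090, Def. 3.1.3, Thm. 8.0.4) at the closed points of LOWER
dimension: on a component of dimension `≤ 1` of the ambient scheme a point `x` of the cosupport of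
`(I, b)` (`max-ord I ≤ b`) is itself a codimension-one component of the cosupport — `𝔪_x = (v)`
for the maximal-contact element `v`, so `I_x = 𝔪_x^b = H_x^b` and one blowing up of the point
resolves (3.111 Step 1) — while off the (closed) cosupport the empty sequence resolves. Hence LOCAL
ORDER REDUCTION AT EVERY CLOSED POINT `x` WITH `dim 𝒪_{X,x} ≤ 2`, in particular at every closed
point of a scheme of dimension `≤ 2` (`ringKrullDim_stalk_le_topologicalKrullDim`).

* `Kollar2007.maximalIdeal_eq_span_of_ringKrullDim_le_one` — in a regular local ring of dimension
  `≤ 1`, an element `v ∈ 𝔪 ∖ 𝔪²` generates `𝔪` (Matsumura Thm. 14.2: `R/(v)` is regular of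
  dimension `dim R - 1 = 0`, a field);
* `Kollar2007.span_pow_le_stalkIdeal_of_idealOrder_le` — if `I_x ⊆ (v^b)`, `v ∈ 𝔪_x` and
  `ord_x I ≤ b` then `I_x = (v^b)`;
* `Kollar2007.exists_isResolutionOf_nhd_of_not_mem_support` — off the cosupport the empty sequence
  resolves (the cosupport is closed in the tame regime, BGMW §3.1 Remark (3));
* `Kollar2007.exists_isResolutionOf_nhd_of_ringKrullDim_le_one` — at a point `x` with
  `dim 𝒪_{X,x} ≤ 1` (closed or not) local order reduction holds in the tame regime;
* **`Kollar2007.exists_isResolutionOf_nhd_of_ringKrullDim_le_two`** — at every CLOSED point `x`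
  with `dim 𝒪_{X,x} ≤ 2`; **`Kollar2007.exists_isResolutionOf_nhd_of_topologicalKrullDim_le_two`**
  — at every closed point of `X` when `dim X ≤ 2`.

## Sources

* J. Kollár, *Lectures on Resolution of Singularities* (2007): Thm. 3.69, 3.70, 3.104 Step 2.2,
  3.111 Step 1, Thm. 3.80. [Kollar2007]
* E. Bierstone, D. Grigoriev, P. Milman, J. Włodarczyk, arXiv:1206.3090: Def. 3.1.3, §3.1
  Remark (3), Thm. 8.0.4. [BierstoneGrigorievMilmanWlodarczyk2011]
* H. Matsumura, *Commutative Ring Theory* (1986), Thm. 14.2. [Matsumura1987]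
-/

noncomputable section

open CategoryTheory CategoryTheory.Limits AlgebraicGeometry TopologicalSpace IsLocalRing
  Scheme.IdealSheafData

namespace Literature.AlgebraicGeometry.Resolution

universe u

namespace Kollar2007

variable (k : Type u) [Field k] (X : Scheme.{u}) [X.Over (Spec (.of k))]

/-! ## Algebra: points of dimension `≤ 1` -/

/-- **In a regular local ring of dimension `≤ 1`, an element `v ∈ 𝔪 ∖ 𝔪²` generates `𝔪`**:
`R/(v)` is regular of dimension `dim R - 1 = 0` (Matsumura Thm. 14.2), hence a field, so
`𝔪 ⊆ (v)`. [cite: Matsumura1987, Thm. 14.2] -/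
theorem maximalIdeal_eq_span_of_ringKrullDim_le_one {R : Type u} [CommRing R] [IsRegularLocalRing R]
    (hdim : ringKrullDim R ≤ 1) {v : R} (hvm : v ∈ maximalIdeal R) (hv2 : v ∉ (maximalIdeal R) ^ 2) :
    maximalIdeal R = Ideal.span {v} := by
  obtain ⟨hSreg, hSdim⟩ := IsRegularLocalRing.quotient_span_singleton hvm hv2
  haveI := hSreg
  -- `dim R/(v) = 0`
  obtain ⟨n, hn⟩ := exists_nat_cast_eq_ringKrullDim (R := R ⧸ Ideal.span {v})
  obtain ⟨m, hm⟩ := exists_nat_cast_eq_ringKrullDim (R := R)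
  rw [hn, hm] at hSdim
  rw [hm] at hdim
  have h1 : n + 1 = m := by
    have : ((n + 1 : ℕ) : WithBot ℕ∞) = ((m : ℕ) : WithBot ℕ∞) := by push_cast; exact hSdim
    exact_mod_cast this
  have h2 : m ≤ 1 := by exact_mod_cast hdim
  have hn0 : n = 0 := by omega
  subst hn0
  -- so the maximal ideal of `R/(v)` is zero
  have hbot : maximalIdeal (R ⧸ Ideal.span {v}) = ⊥ := by
    have hfr := hSreg.spanFinrank_maximalIdeal
    rw [hn] at hfr
    have h0 : (maximalIdeal (R ⧸ Ideal.span {v})).spanFinrank = 0 := by exact_mod_cast hfr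
    exact (Submodule.spanFinrank_eq_zero_iff_eq_bot (IsNoetherian.noetherian _)).mp h0
  refine le_antisymm ?_ ((Ideal.span_singleton_le_iff_mem _).mpr hvm)
  have hmap : (maximalIdeal R).map (Ideal.Quotient.mk (Ideal.span {v})) = ⊥ := by
    rw [map_maximalIdeal_of_surjective _ Ideal.Quotient.mk_surjective, hbot]
  rw [Ideal.map_eq_bot_iff_le_ker, Ideal.mk_ker] at hmap
  exact hmap

/-- **`I_x = (v^b)` from `I_x ⊆ (v^b)`, `v ∈ 𝔪_x` and `ord_x I ≤ b`**: an element of `I_x` outside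
`𝔪_x^{b+1}` is `v^b` times a unit. [cite: Kollar2007, 3.111 Step 1 (p. 176)] -/
theorem stalkIdeal_eq_span_pow_of_le {I : X.IdealSheafData} {x : X} {b : ℕ} {v : X.presheaf.stalk x}
    (hvm : v ∈ maximalIdeal (X.presheaf.stalk x)) (hle : stalkIdeal I x ≤ Ideal.span {v ^ b})
    (hxI : idealOrder I x ≤ b) : stalkIdeal I x = Ideal.span {v ^ b} := by
  refine le_antisymm hle ?_
  have hnot : ¬ stalkIdeal I x ≤ maximalIdeal (X.presheaf.stalk x) ^ (b + 1) := by
    intro h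
    have h' := ((le_idealOrder_iff I x (b + 1)).mpr h).trans hxI
    exact absurd (ENat.coe_le_coe.mp h') (by omega)
  obtain ⟨f, hfI, hfb⟩ := SetLike.not_le_iff_exists.mp hnot
  obtain ⟨g, rfl⟩ := Ideal.mem_span_singleton.mp (hle hfI)
  have hg : IsUnit g := by
    by_contra hg
    apply hfb
    rw [pow_succ]
    exact Ideal.mul_mem_mul (Ideal.pow_mem_pow hvm b) ((mem_maximalIdeal _).mpr hg)
  rw [Ideal.span_singleton_le_iff_mem]
  have : v ^ b = v ^ b * g * ↑hg.unit⁻¹ := by rw [mul_assoc, IsUnit.mul_val_inv, mul_one]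
  rw [this]
  exact Ideal.mul_mem_right _ _ hfI

/-! ## Off the cosupport; points of dimension `≤ 1` -/

/-- **Off the (closed) cosupport the empty sequence resolves.** For `X` smooth over a perfect field
`k` of characteristic `p`, `1 ≤ b`, `p = 0 ∨ b ≤ p` (so that `cosupp(I, b) = V(MC(I))` is closed)
and `x ∉ cosupp(I, b)`: on `U = X ∖ cosupp(I, b)` the marked ideal `(U, I|_U, ∅, b)` has empty
cosupport. [cite: BierstoneGrigorievMilmanWlodarczyk2011, §3.1 Remark (3), Def. 3.1.3] -/
theorem exists_isResolutionOf_nhd_of_not_mem_support (p : ℕ) [CharP k p] [PerfectField k]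
    [Smooth (X ↘ Spec (.of k))] (I : X.IdealSheafData) {b : ℕ} (hbp : p = 0 ∨ b ≤ p) (x : X)
    (hx : x ∉ (⟨I, [], b⟩ : MarkedIdeal X).support) :
    ∃ (U : X.Opens) (_ : x ∈ U) (s : CentreSeq (U : Scheme.{u})),
      s.IsResolutionOf ⟨I.comap U.ι, [], b⟩ := by
  haveI : IsLocallyNoetherian X := isLocallyNoetherian_of_locallyOfFiniteType_over k X
  have hF : IsClosed (⟨I, [], b⟩ : MarkedIdeal X).support :=
    MarkedIdeal.isClosed_support (hasFinitePresentationDifferentials_overHom k X)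
      (hasLocalCoordinates_overHom k X) _
      (fun y j hj hjb => isUnit_natCast_stalk_of_char k X p hbp y j hj hjb)
  let V : X.Opens := ⟨((⟨I, [], b⟩ : MarkedIdeal X).support)ᶜ, hF.isOpen_compl⟩
  refine ⟨V, hx, CentreSeq.nil _, (CentreSeq.isResolutionOf_nil_iff _).mpr ?_⟩
  have : (⟨I.comap V.ι, [], b⟩ : MarkedIdeal (V : Scheme.{u})) =
      (⟨I, [], b⟩ : MarkedIdeal X).comap V.ι := rfl
  rw [this, MarkedIdeal.support_comap_of_isOpenImmersion]
  refine Set.eq_empty_iff_forall_notMem.mpr fun y hy => ?_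
  exact y.2 hy

/-- **Local order reduction at a point of dimension `≤ 1`, tame regime.** For `X` smooth over a
perfect field `k` of characteristic `p` (`p = 0` allowed), `max-ord I ≤ b`, `1 ≤ b`,
`p = 0 ∨ b < p`, and a point `x` with `dim 𝒪_{X,x} ≤ 1`: some open `U ∋ x` carries a blow-up
sequence resolving `(U, I|_U, ∅, b)`. If `x ∈ cosupp(I, b)` then, `v` being the maximal-contact
element at `x` (`KollarMaximalContactTame.lean`), `𝔪_x = (v)` and `I_x = (v^b) = H_x^b`, so one
blowing up resolves (`exists_isResolutionOf_nhd_of_stalkIdeal_eq_pow`); otherwise the empty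
sequence does. [cite: Kollar2007, Thm. 3.69, 3.111 Step 1, Thm. 3.80] -/
theorem exists_isResolutionOf_nhd_of_ringKrullDim_le_one (p : ℕ) [CharP k p] [PerfectField k]
    [Smooth (X ↘ Spec (.of k))] (I : X.IdealSheafData) {b : ℕ} (hb : 1 ≤ b) (hbp : p = 0 ∨ b < p)
    (hmax : ∀ x : X, idealOrder I x ≤ b) (x : X) (hdim : ringKrullDim (X.presheaf.stalk x) ≤ 1) :
    ∃ (U : X.Opens) (_ : x ∈ U) (s : CentreSeq (U : Scheme.{u})),
      s.IsResolutionOf ⟨I.comap U.ι, [], b⟩ := by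
  classical
  haveI : IsLocallyNoetherian X := isLocallyNoetherian_of_locallyOfFiniteType_over k X
  by_cases hx : x ∈ (⟨I, [], b⟩ : MarkedIdeal X).support
  swap
  · exact exists_isResolutionOf_nhd_of_not_mem_support k X p I (hbp.imp id le_of_lt) x hx
  obtain ⟨U, hxU, H, -, hH, hsub, -⟩ := exists_isMaxContact_nhd_of_char k X p I hb hbp hmax x
  haveI : Smooth ((U : Scheme.{u}) ↘ Spec (.of k)) :=
    inferInstanceAs (Smooth (U.ι ≫ X ↘ Spec (.of k)))
  haveI : IsLocallyNoetherian (U : Scheme.{u}) := isLocallyNoetherian_of_locallyOfFiniteType_over k _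
  have hUreg : Scheme.IsRegular (U : Scheme.{u}) := Scheme.isRegular_of_smooth_over_field k _
  let xU : (U : Scheme.{u}) := ⟨x, hxU⟩
  have hxsupp : xU ∈ (⟨I.comap U.ι, [], b⟩ : MarkedIdeal (U : Scheme.{u})).support := by
    have : (⟨I.comap U.ι, [], b⟩ : MarkedIdeal (U : Scheme.{u})) =
        (⟨I, [], b⟩ : MarkedIdeal X).comap U.ι := rfl
    rw [this, MarkedIdeal.support_comap_of_isOpenImmersion]
    exact hx
  haveI := hUreg xU
  obtain ⟨v, hv, hv2⟩ := hH xU (hsub hxsupp)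
  have hvm : v ∈ maximalIdeal ((U : Scheme.{u}).presheaf.stalk xU) :=
    (mem_support_iff_stalkIdeal_le H xU).mp (hsub hxsupp) (hv ▸ Ideal.mem_span_singleton_self v)
  have hdimU : ringKrullDim ((U : Scheme.{u}).presheaf.stalk xU) ≤ 1 := by
    rw [ringKrullDim_stalk_opens]; exact hdim
  have hmv : maximalIdeal ((U : Scheme.{u}).presheaf.stalk xU) = Ideal.span {v} :=
    maximalIdeal_eq_span_of_ringKrullDim_le_one hdimU hvm hv2
  have hle : stalkIdeal (I.comap U.ι) xU ≤ Ideal.span {v ^ b} := by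
    have h1 : stalkIdeal (I.comap U.ι) xU ≤ maximalIdeal ((U : Scheme.{u}).presheaf.stalk xU) ^ b :=
      (MarkedIdeal.mem_support_iff (⟨I.comap U.ι, [], b⟩ : MarkedIdeal (U : Scheme.{u})) xU).mp hxsupp
    rw [hmv, Ideal.span_singleton_pow] at h1
    exact h1
  have hIx : stalkIdeal (I.comap U.ι) xU = stalkIdeal (H ^ b) xU := by
    rw [stalkIdeal_eq_span_pow_of_le (U : Scheme.{u}) hvm hle
      (by rw [idealOrder_comap_of_isOpenImmersion]; exact hmax x), stalkIdeal_pow, hv,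
      Ideal.span_singleton_pow]
  exact exists_isResolutionOf_nhd_of_opens X I b U xU
    (exists_isResolutionOf_nhd_of_stalkIdeal_eq_pow (U : Scheme.{u}) hUreg (I.comap U.ι) hb hH hIx)

/-! ## Every closed point of dimension `≤ 2` -/

/-- **Local order reduction at every closed point of dimension `≤ 2`, tame regime.** For `X` smooth
over a perfect field `k` of characteristic `p` (`p = 0` allowed), `max-ord I ≤ b`, `1 ≤ b`,
`p = 0 ∨ b < p`, and a closed point `x` with `dim 𝒪_{X,x} ≤ 2`: some open `U ∋ x` carries a blow-up
sequence RESOLVING `(U, I|_U, ∅, b)` (BGMW Def. 3.1.3). Surface points: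
`exists_isResolutionOf_nhd_of_closedPoint`; lower-dimensional points:
`exists_isResolutionOf_nhd_of_ringKrullDim_le_one`.
[cite: Kollar2007, Thm. 3.69, 3.70, 3.104 Step 2.2, 3.111 Step 1]
[cite: BierstoneGrigorievMilmanWlodarczyk2011, Def. 3.1.3, Thm. 8.0.4] -/
theorem exists_isResolutionOf_nhd_of_ringKrullDim_le_two (p : ℕ) [CharP k p] [PerfectField k]
    [Smooth (X ↘ Spec (.of k))] (I : X.IdealSheafData) {b : ℕ} (hb : 1 ≤ b) (hbp : p = 0 ∨ b < p)
    (hmax : ∀ x : X, idealOrder I x ≤ b) (x : X) (hxcl : IsClosed ({x} : Set X))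
    (hdim : ringKrullDim (X.presheaf.stalk x) ≤ 2) :
    ∃ (U : X.Opens) (_ : x ∈ U) (s : CentreSeq (U : Scheme.{u})),
      s.IsResolutionOf ⟨I.comap U.ι, [], b⟩ := by
  haveI : IsLocallyNoetherian X := isLocallyNoetherian_of_locallyOfFiniteType_over k X
  obtain ⟨m, hm⟩ := exists_nat_cast_eq_ringKrullDim (R := X.presheaf.stalk x)
  by_cases h2 : ringKrullDim (X.presheaf.stalk x) = 2
  · exact exists_isResolutionOf_nhd_of_closedPoint k X p I hb hbp hmax x hxcl h2
  · refine exists_isResolutionOf_nhd_of_ringKrullDim_le_one k X p I hb hbp hmax x ?_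
    rw [hm] at hdim h2 ⊢
    have h2' : m ≠ 2 := fun h => h2 (by rw [h]; rfl)
    have hle : m ≤ 2 := by exact_mod_cast hdim
    exact_mod_cast (show m ≤ 1 by omega)

/-- **Local order reduction at every closed point of a scheme of dimension `≤ 2`, tame regime**
(`dim 𝒪_{X,x} ≤ dim X`, `ringKrullDim_stalk_le_topologicalKrullDim`).
[cite: Kollar2007, Thm. 3.69, 3.70] [cite: BierstoneGrigorievMilmanWlodarczyk2011, Thm. 8.0.4] -/
theorem exists_isResolutionOf_nhd_of_topologicalKrullDim_le_two (p : ℕ) [CharP k p] [PerfectField k]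
    [Smooth (X ↘ Spec (.of k))] (hX : topologicalKrullDim X ≤ 2) (I : X.IdealSheafData) {b : ℕ}
    (hb : 1 ≤ b) (hbp : p = 0 ∨ b < p) (hmax : ∀ x : X, idealOrder I x ≤ b) (x : X)
    (hxcl : IsClosed ({x} : Set X)) :
    ∃ (U : X.Opens) (_ : x ∈ U) (s : CentreSeq (U : Scheme.{u})),
      s.IsResolutionOf ⟨I.comap U.ι, [], b⟩ :=
  exists_isResolutionOf_nhd_of_ringKrullDim_le_two k X p I hb hbp hmax x hxcl
    ((ringKrullDim_stalk_le_topologicalKrullDim X x).trans hX)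

end Kollar2007

end Literature.AlgebraicGeometry.Resolution

end
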